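import Summits.BirchSwinnertonDyer.BirchSwinnertonDyer.Theorems.ByReductionTypeAtTwoAdditiveReducibleSplitTwistKatoMemberDefs
import Summits.BirchSwinnertonDyer.BirchSwinnertonDyer.Theorems.ByReductionTypeAtTwoAdditiveRankZeroResidualV9
import Summits.BirchSwinnertonDyer.BirchSwinnertonDyer.Theorems.ByReductionTypeAtTwoAdditivePotMultOverKAtTwoPrice
import HarnessLib

/-!
# Crux `AdditiveRankZeroAtTwo` (K4 item 19098), child C4″ `AdditivePotMultOverKAtTwo` (item stmt-BirchSwinnertonDyer-22618)
# NARROWED TO ZERO OVER-`K` CONTENT: the UPPER half at `2` on the `E[2]`-REDUCIBLE split-twist potentially multiplicative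
# curves from the two member-sharp block targets (`…ReducibleSplitTwistKatoMemberDefs.lean`), hence the Kato half on the
# WHOLE potentially multiplicative block from {2 readings, 4 block targets, (A) on the `S₃`-image curves}, hence
# C4″ BY NAME ⟸ PRINT + sibling + those + the LOWER half over `ℚ` on the block — and C4″ ⟺ that lower half

Seat `bsd-2adic-k4-w3` GEN 0 (prover, cell `bsd-2adic`, rung K4; explicit unit of director-bsd g16 (309)(7)). `--supports
stmt-BirchSwinnertonDyer-22618` helper. HONEST FRAMING (D-0036/D-0054): CONDITIONAL theorems — every research-grade input is a
displayed hypothesis BY NAME; types-the-object-of; closes nothing at the `∀`-level; nothing booked; BSD is not proved by any of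
this. PARTITION: X5@2 additive potentially multiplicative block (463 census classes; the new content is on its 50 reducible
split-twist classes) × `p = 2`.

WHAT THIS FILE DOES (patterns: `…AdditiveReducibleKatoMemberSharpNST.lean` §2–§3, p674406; `…AdditivePotMultKatoHalf.lean` §4,
p653249; `…AdditiveKatoTransportDefs.lean` §3, p680350; `…AdditivePotMultOverKAtTwoPrice.lean` §2, p651678).
* §1 `katoMemberSharp_two_additiveReducible_of_reading_of_targets` — the member-sharp bound on EVERY non-CM globally minimal
  ADDITIVE curve with REDUCIBLE `W[2]`, `L(W,1) ≠ 0`, `Ш` finite: under (NST′) it is the THEOREM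
  `katoMemberShaBound_two_sharp_NST` (reading `hinS` + Lim@2 + FW + modularity), off (NST′) the block targets `hR₁`/`hR₂`.
* §2 `missingUpperBoundAt_two_of_katoMemberSharp_splitTwistReducible` (+ the one-block doors `…_negOneSplitTwist`,
  `…_negTwoSplitTwist`) — `MissingUpperBoundAt W 2` on the reducible split-twist curves: Miller currency
  (`missingUpperBoundAt_of_sharpKatoCurrency`) + Cassels transport from the member (`TwistComparison.missingUpperBoundAt_of_isIsogenous`).
* §3 `addReducibleUpper_two_of_sharpMember_of_targets` — the upper half on the WHOLE additive reducible block (potentially good ∪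
  potentially multiplicative, any twist class); `addPotMultSplitTwist_reducibleUpper_two_of_targets` — keyed to v9's `hQKm9`
  habitat (`¬CM → r_an = 0 → Addv W 2 → ord₂ j < 0 → ¬ irreducible → ¬(NST′) → MissingUpperBoundAt W 2`).
* §4 `addPotMult_upper_two_of_readings_of_targets` — THE KATO HALF ON THE WHOLE POTENTIALLY MULTIPLICATIVE BLOCK from
  READINGS {`hNST2`, `hinS`} + TARGETS {`h₁`, `h₂` (irreducible blocks, GEN 16), `hR₁`, `hR₂` (reducible blocks, this seat)} +
  PRINT {GZK, modularity ×2, Lim@2, FW, Cassels} + ONE research object: (A) at `(W,2)` on the irreducible curves with NON-abelian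
  `ℚ(E[2])` (`hAnaMI`, v8's binder). No over-`K` object, no Milne, no Hoffstein–Luo, no sibling.
* §5 **`additivePotMultOverKAtTwo_of_readings_of_targets_of_lower`** — the route decl C4″
  `Summit.BirchSwinnertonDyer.BirchSwinnertonDyer.Theses.ByReductionTypeAtTwo.AdditivePotMultOverKAtTwo` VERBATIM from §4 + the
  LOWER half over `ℚ` on the block (`hLowM`) through the Price door `additivePotMultOverKAtTwo_of_upper_of_lower` (PRINT
  {GZK, modularity, Milne any-model} + the sibling `MultiplicativeRankZeroAtTwo` for the over-`K` dress); and
  `additivePotMultOverKAtTwo_iff_lower_of_readings_of_targets` — GRANTED all of §4's names (+ Hoffstein–Luo for the forward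
  direction), C4″ ⟺ the lower half over `ℚ` on the potentially multiplicative block. I.e. after this file C4″'s honest residual
  is {the Eisenstein half on 463 classes, (A) on the `S₃`-image pot-mult curves} modulo {2 readings, 4 Kato-side block targets
  (each = Kato's Conj. 12.10 at the exceptional prime of (12.5.1), reading-grade modulo the odd-branch package), PRINT, sibling}.
* §6 `hLowM_of_additivePotMultOverKAtTwo` — conversely the lower-half binder is implied by C4″ (+ PRINT + sibling + HL): it is a
  genuine PART of the child, not an import (bookkeeping).

References: [Kato2004Asterisque] Thm. 12.5 (3)(4) and (12.5.1) (p. 222), Thm. 12.6 (p. 222), Conj. 12.10 (p. 224), 13.13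
(pp. 233–234), §14.14–Prop. 14.16 (pp. 243–245), §17.13 (p. 280); [GreenbergLNM1716] Thm. 1.14; [MazurTateTeitelbaum1986Invent]
§I.17; [MazurRubin2004] Thm. 2.3.4; [CoatesSujatha2005] statement (A); [Lim2017FineSelmer] Thm. 3.5; [FerreroWashington1979];
[Cassels1965ArithmeticVIII]; [MilneADT2006] I.7.3; [Milne1972ArithmeticAV] Thm. 1; [HoffsteinLuo1997]; [Miller2011LMS] Def. 1.1.
-/

set_option autoImplicit false
set_option linter.dupNamespace false

noncomputable section

open scoped Classical

namespace Summit.BirchSwinnertonDyer.BirchSwinnertonDyer.Theorems.AddKatoTwo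

open WeierstrassCurve Literature.NumberTheory.EllipticCurves
  Literature.NumberTheory.EllipticCurves.ModularForms
  Literature.NumberTheory.EllipticCurves.Kato2004
  Literature.NumberTheory.EllipticCurves.Rank1Residual
  Literature.NumberTheory.EllipticCurves.Rank1Residual.Typed
  Literature.NumberTheory.IwasawaTheory
  Summit.BirchSwinnertonDyer.Rank1Residual Summit.BirchSwinnertonDyer.Rank1Residual.Additive
  Summit.BirchSwinnertonDyer.Rank1Residual.AdditivePotMult
  Summit.BirchSwinnertonDyer.Rank1Residual.X5.AddTwoL2
  Summit.BirchSwinnertonDyer.BirchSwinnertonDyer.Theses.ByReductionTypeAtTwo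
  Summit.BirchSwinnertonDyer.BirchSwinnertonDyer.Theorems.SemistableKatoTwo

/-! ## §1 The member-sharp bound on EVERY additive reducible curve: (NST′) by the theorem, off (NST′) by the targets -/

/-- **The MEMBER-SHARP Kato-at-`2` bound for EVERY globally minimal non-CM `W` ADDITIVE at `2` with REDUCIBLE `W[2]`,
`L(W,1) ≠ 0`, `Ш(W)` finite** — no twist hypothesis: under (NST′) the theorem `katoMemberShaBound_two_sharp_NST` (the
(NST′)-sharp member reading `hinS` + modularity `hmodN` + Lim@2 + Ferrero–Washington), otherwise the block targets `hR₁`/`hR₂`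
(`katoMemberSharpAtTwoAdditiveSplitTwistReducible_of_negOne_of_negTwo`). Conditional on the names; nothing asserted.
[cite: Kato2004Asterisque, Thm. 12.5 (3) and (12.5.1) (p. 222), Conj. 12.10 (p. 224), Prop. 14.16 (2) and its proof (pp. 244–245)]
[cite: Lim2017FineSelmer, §3 Thm. 3.5] [cite: FerreroWashington1979, Theorem] -/
theorem katoMemberSharp_two_additiveReducible_of_reading_of_targets (hmodN : exists_isNewformOf)
    (hinS : Kato2004.exists_memberHullInputs_two_sharp_of_noSplitTwistNegOneNegTwo)
    (hLim2 : Lim2017.thm35_at_two_fineSelmerDual_moduleFinite_of_classicalMuVanishes_of_le_divisionField_four)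
    (hFW : ferreroWashington1979_classicalMuVanishes)
    (hR₁ : KatoMemberSharpAtTwoAdditiveNegOneSplitTwistReducible)
    (hR₂ : KatoMemberSharpAtTwoAdditiveNegTwoSplitTwistReducible)
    (W : WeierstrassCurve ℚ) [W.IsElliptic] [W.IsGloballyMinimal] (hcm : ¬ W.HasCM)
    (hng : ¬ W.HasGoodReductionAtPrime 2) (hnm : ¬ W.HasMultiplicativeReductionAtPrime 2)
    (hred : ¬ W.HasIrreducibleModPGaloisRep 2) (hL : W.entireLFunction 1 ≠ 0) (hfin : Finite W.sha) :
    ∃ (W' : WeierstrassCurve ℚ) (_ : W'.IsElliptic) (_ : W'.IsGloballyMinimal),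
      IsIsogenous W W' ∧ Finite W'.sha ∧
      ∃ q : ℚ, W'.entireLFunction 1 / (W'.realPeriodRat : ℂ) = (q : ℂ) ∧
        (padicValNat 2 (Nat.card (AddCommGroup.primaryComponent W'.sha 2)) : ℤ) +
            padicValNat 2 W'.tamagawaProduct ≤
          padicValRat 2 q + 2 * (padicValNat 2 W'.torsionOrder : ℤ) := by
  by_cases hnst : ∀ d : ℚ, d = -1 ∨ d = -2 → ¬ (W.quadraticTwist d).HasSplitMultiplicativeReductionAtPrime 2
  · exact katoMemberShaBound_two_sharp_NST hmodN hinS hLim2 hFW W hcm hng hnm hnst hred hL hfin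
  · exact katoMemberSharpAtTwoAdditiveSplitTwistReducible_of_negOne_of_negTwo hR₁ hR₂ W hcm hng hnm hnst hred hL hfin

/-! ## §2 `MissingUpperBoundAt W 2` on the reducible split-twist curves (Miller currency + Cassels transport) -/

/-- **The UPPER half at `2` on the `E[2]`-REDUCIBLE additive curves WITH a split multiplicative twist by `−1` or `−2`** (the
habitat of v9's over-`K` binder `hQKm9`; 50 census classes): for `W` globally minimal, non-CM, additive at `2`, NOT (NST′),
`W[2]` reducible, `r_an(W) = 0` — `MissingUpperBoundAt W 2`, GRANTED the two block targets `hR₁`, `hR₂` (R14: Kato's member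
package with Conj. 12.10 at the exceptional prime, reading-grade modulo the odd-branch package), Cassels (`hCassels`), GZK
(`hGZK`) and modularity (`hrat`). Proof = `missingUpperBoundAt_two_of_sharpMemberBound`'s: `L(W,1) ≠ 0` (modularity), `Ш(W)`
finite (GZK), the member-sharp bound at `W_K ∼ W`, Miller currency at `W_K`, Cassels transport to `W`. NO over-`K` object, NO
Milne, NO Hoffstein–Luo, NO sibling crux, NO statement (A). Conditional; nothing asserted.
[cite: Kato2004Asterisque, Conj. 12.10 (p. 224), Prop. 14.16 (2) and its proof (pp. 244–245)] [cite: Cassels1965ArithmeticVIII]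
[cite: MilneADT2006, Thm. I.7.3] [cite: Miller2011LMS, Def. 1.1] -/
theorem missingUpperBoundAt_two_of_katoMemberSharp_splitTwistReducible
    (hR₁ : KatoMemberSharpAtTwoAdditiveNegOneSplitTwistReducible)
    (hR₂ : KatoMemberSharpAtTwoAdditiveNegTwoSplitTwistReducible)
    (hCassels : bsdRHS_eq_of_isIsogenous)
    (hGZK : rank_eq_analyticRank_of_analyticRank_le_one) (hrat : hasEntireLFunction_rat)
    (W : WeierstrassCurve ℚ) [W.IsElliptic] [W.IsGloballyMinimal] (hcm : ¬ W.HasCM)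
    (hng : ¬ W.HasGoodReductionAtPrime 2) (hnm : ¬ W.HasMultiplicativeReductionAtPrime 2)
    (hst : ¬ (∀ d : ℚ, d = -1 ∨ d = -2 → ¬ (W.quadraticTwist d).HasSplitMultiplicativeReductionAtPrime 2))
    (hred : ¬ W.HasIrreducibleModPGaloisRep 2) (hr : W.analyticRank = 0) :
    MissingUpperBoundAt W 2 := by
  have hL : W.entireLFunction 1 ≠ 0 := (W.analyticRank_eq_zero_iff_holds (hrat W)).mp hr
  have hr1 : W.analyticRank ≤ 1 := by rw [hr]; exact zero_le_one
  have hfinW : W.ShaFinite := (hGZK W hr1).2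
  obtain ⟨W', hE', hM', hiso, hfin', q, hq, hle⟩ :=
    katoMemberSharpAtTwoAdditiveSplitTwistReducible_of_negOne_of_negTwo hR₁ hR₂ W hcm hng hnm hst hred hL hfinW
  haveI := hE'
  haveI := hM'
  have hr' : W'.analyticRank = 0 := by rw [← analyticRank_eq_of_isIsogenous' hiso, hr]
  have hr1' : W'.analyticRank ≤ 1 := by rw [hr']; exact zero_le_one
  have hW' : MissingUpperBoundAt W' 2 :=
    missingUpperBoundAt_of_sharpKatoCurrency hGZK hrat W' 2 hr' hfin' hq hle
  exact TwistComparison.missingUpperBoundAt_of_isIsogenous _ W 2 hCassels hGZK hrat hiso.symm_of_charZero hr1' hW'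

/-- **The (−1)-block door alone**: `MissingUpperBoundAt W 2` for an additive reducible rank-`0` `W` whose twist by `−1` is split
multiplicative at `2`, from `hR₁` + Cassels + GZK + modularity. [cite: Kato2004Asterisque, Conj. 12.10 (p. 224), Prop. 14.16 (2) (p. 244)]
[cite: Cassels1965ArithmeticVIII] [cite: Miller2011LMS, Def. 1.1] -/
theorem missingUpperBoundAt_two_of_katoMemberSharp_negOneSplitTwist
    (hR₁ : KatoMemberSharpAtTwoAdditiveNegOneSplitTwistReducible)
    (hCassels : bsdRHS_eq_of_isIsogenous)
    (hGZK : rank_eq_analyticRank_of_analyticRank_le_one) (hrat : hasEntireLFunction_rat)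
    (W : WeierstrassCurve ℚ) [W.IsElliptic] [W.IsGloballyMinimal] (hcm : ¬ W.HasCM)
    (hng : ¬ W.HasGoodReductionAtPrime 2) (hnm : ¬ W.HasMultiplicativeReductionAtPrime 2)
    (hsp : (W.quadraticTwist (-1)).HasSplitMultiplicativeReductionAtPrime 2)
    (hred : ¬ W.HasIrreducibleModPGaloisRep 2) (hr : W.analyticRank = 0) :
    MissingUpperBoundAt W 2 := by
  have hL : W.entireLFunction 1 ≠ 0 := (W.analyticRank_eq_zero_iff_holds (hrat W)).mp hr
  have hr1 : W.analyticRank ≤ 1 := by rw [hr]; exact zero_le_one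
  have hfinW : W.ShaFinite := (hGZK W hr1).2
  obtain ⟨W', hE', hM', hiso, hfin', q, hq, hle⟩ := hR₁ W hcm hng hnm hsp hred hL hfinW
  haveI := hE'
  haveI := hM'
  have hr' : W'.analyticRank = 0 := by rw [← analyticRank_eq_of_isIsogenous' hiso, hr]
  have hr1' : W'.analyticRank ≤ 1 := by rw [hr']; exact zero_le_one
  have hW' : MissingUpperBoundAt W' 2 :=
    missingUpperBoundAt_of_sharpKatoCurrency hGZK hrat W' 2 hr' hfin' hq hle
  exact TwistComparison.missingUpperBoundAt_of_isIsogenous _ W 2 hCassels hGZK hrat hiso.symm_of_charZero hr1' hW'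

/-- **The (−2)-block door alone** (twin of `missingUpperBoundAt_two_of_katoMemberSharp_negOneSplitTwist`).
[cite: Kato2004Asterisque, Conj. 12.10 (p. 224), Prop. 14.16 (2) (p. 244)] [cite: Cassels1965ArithmeticVIII] [cite: Miller2011LMS, Def. 1.1] -/
theorem missingUpperBoundAt_two_of_katoMemberSharp_negTwoSplitTwist
    (hR₂ : KatoMemberSharpAtTwoAdditiveNegTwoSplitTwistReducible)
    (hCassels : bsdRHS_eq_of_isIsogenous)
    (hGZK : rank_eq_analyticRank_of_analyticRank_le_one) (hrat : hasEntireLFunction_rat)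
    (W : WeierstrassCurve ℚ) [W.IsElliptic] [W.IsGloballyMinimal] (hcm : ¬ W.HasCM)
    (hng : ¬ W.HasGoodReductionAtPrime 2) (hnm : ¬ W.HasMultiplicativeReductionAtPrime 2)
    (hsp : (W.quadraticTwist (-2)).HasSplitMultiplicativeReductionAtPrime 2)
    (hred : ¬ W.HasIrreducibleModPGaloisRep 2) (hr : W.analyticRank = 0) :
    MissingUpperBoundAt W 2 := by
  have hL : W.entireLFunction 1 ≠ 0 := (W.analyticRank_eq_zero_iff_holds (hrat W)).mp hr
  have hr1 : W.analyticRank ≤ 1 := by rw [hr]; exact zero_le_one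
  have hfinW : W.ShaFinite := (hGZK W hr1).2
  obtain ⟨W', hE', hM', hiso, hfin', q, hq, hle⟩ := hR₂ W hcm hng hnm hsp hred hL hfinW
  haveI := hE'
  haveI := hM'
  have hr' : W'.analyticRank = 0 := by rw [← analyticRank_eq_of_isIsogenous' hiso, hr]
  have hr1' : W'.analyticRank ≤ 1 := by rw [hr']; exact zero_le_one
  have hW' : MissingUpperBoundAt W' 2 :=
    missingUpperBoundAt_of_sharpKatoCurrency hGZK hrat W' 2 hr' hfin' hq hle
  exact TwistComparison.missingUpperBoundAt_of_isIsogenous _ W 2 hCassels hGZK hrat hiso.symm_of_charZero hr1' hW'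

/-! ## §3 The upper half on the WHOLE additive reducible block; the block form keyed to v9's `hQKm9` habitat -/

/-- **The UPPER half at `2` on the WHOLE `E[2]`-REDUCIBLE additive non-CM rank-`0` block** — potentially good, potentially
multiplicative (NST′), and potentially multiplicative split-twist alike: `¬CM → r_an = 0 → Addv W 2 → ¬ irreducible →
MissingUpperBoundAt W 2`, from the (NST′)-sharp member reading `hinS` (THEOREM-side via `katoMemberShaBound_two_sharp_NST`) on its
half and the block targets `hR₁`/`hR₂` on the other, + PRINT {modularity ×2, Lim@2, FW, Cassels, GZK}. No side condition, no
parity, no (A), no over-`K`. Conditional; nothing asserted. [cite: Kato2004Asterisque, Thm. 12.6 (p. 222), Conj. 12.10 (p. 224), Prop. 14.16 (2) and its proof (pp. 244–245)]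
[cite: Cassels1965ArithmeticVIII] [cite: Lim2017FineSelmer, §3 Thm. 3.5] [cite: FerreroWashington1979, Theorem] -/
theorem addReducibleUpper_two_of_sharpMember_of_targets (hmodN : exists_isNewformOf) (hrat : hasEntireLFunction_rat)
    (hinS : Kato2004.exists_memberHullInputs_two_sharp_of_noSplitTwistNegOneNegTwo)
    (hLim2 : Lim2017.thm35_at_two_fineSelmerDual_moduleFinite_of_classicalMuVanishes_of_le_divisionField_four)
    (hFW : ferreroWashington1979_classicalMuVanishes) (hCassels : bsdRHS_eq_of_isIsogenous)
    (hGZK : rank_eq_analyticRank_of_analyticRank_le_one)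
    (hR₁ : KatoMemberSharpAtTwoAdditiveNegOneSplitTwistReducible)
    (hR₂ : KatoMemberSharpAtTwoAdditiveNegTwoSplitTwistReducible) :
    ∀ (W : WeierstrassCurve ℚ) [W.IsElliptic] [W.IsGloballyMinimal], ¬ W.HasCM → W.analyticRank = 0 →
      Addv W 2 → ¬ W.HasIrreducibleModPGaloisRep 2 → MissingUpperBoundAt W 2 := by
  intro W _ _ hcm hr hadd hred
  by_cases hnst : ∀ d : ℚ, d = -1 ∨ d = -2 → ¬ (W.quadraticTwist d).HasSplitMultiplicativeReductionAtPrime 2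
  · exact missingUpperBoundAt_two_of_katoMemberSharp_two_NST hmodN hinS hLim2 hFW hCassels hGZK hrat W hcm hadd.1 hadd.2
      hnst hred hr
  · exact missingUpperBoundAt_two_of_katoMemberSharp_splitTwistReducible hR₁ hR₂ hCassels hGZK hrat W hcm hadd.1 hadd.2
      hnst hred hr

/-- **The UPPER half on v9's over-`K` habitat** — the `E[2]`-REDUCIBLE potentially MULTIPLICATIVE curves WITH a split twist by
`−1` or `−2`, keyed `¬CM → r_an = 0 → Addv W 2 → ord₂ j < 0 → ¬ irreducible → ¬(NST′) → MissingUpperBoundAt W 2` (the habitat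
of `hQKm9` in `additiveRankZeroAtTwo_of_residual_v9`), from the two block targets + Cassels + GZK + modularity. So NO curve of
the additive block needs the over-`K` object for its UPPER half any more. Conditional; nothing asserted.
[cite: Kato2004Asterisque, Conj. 12.10 (p. 224), Prop. 14.16 (2) (p. 244)] [cite: Cassels1965ArithmeticVIII] [cite: Miller2011LMS, Def. 1.1] -/
theorem addPotMultSplitTwist_reducibleUpper_two_of_targets
    (hR₁ : KatoMemberSharpAtTwoAdditiveNegOneSplitTwistReducible)
    (hR₂ : KatoMemberSharpAtTwoAdditiveNegTwoSplitTwistReducible)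
    (hCassels : bsdRHS_eq_of_isIsogenous)
    (hGZK : rank_eq_analyticRank_of_analyticRank_le_one) (hrat : hasEntireLFunction_rat) :
    ∀ (W : WeierstrassCurve ℚ) [W.IsElliptic] [W.IsGloballyMinimal], ¬ W.HasCM → W.analyticRank = 0 →
      Addv W 2 → padicValRat 2 W.j < 0 → ¬ W.HasIrreducibleModPGaloisRep 2 →
      ¬ (∀ d : ℚ, d = -1 ∨ d = -2 → ¬ (W.quadraticTwist d).HasSplitMultiplicativeReductionAtPrime 2) →
      MissingUpperBoundAt W 2 := by
  intro W _ _ hcm hr hadd _ hred hst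
  exact missingUpperBoundAt_two_of_katoMemberSharp_splitTwistReducible hR₁ hR₂ hCassels hGZK hrat W hcm hadd.1 hadd.2
    hst hred hr

/-! ## §4 THE KATO HALF ON THE WHOLE POTENTIALLY MULTIPLICATIVE BLOCK -/

/-- **THE KATO HALF AT `2` ON THE WHOLE POTENTIALLY MULTIPLICATIVE ADDITIVE BLOCK** (463 census classes): for every globally
minimal non-CM `W` of analytic rank `0`, additive at `2` with `ord₂ j < 0`: `MissingUpperBoundAt W 2`, GRANTED
READINGS {`hNST2` (D-audit PASS), `hinS` (hMHnst@2 + R12♯, AS-PRINTED)} + TARGETS {`h₁`, `h₂` = the irreducible (−1)/(−2)-blocks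
(`KatoSharpAtTwoAdditiveNeg{One,Two}SplitTwist`, addL2x GEN 16, T20), `hR₁`, `hR₂` = the reducible (−1)/(−2)-blocks (this
seat, R14)} + PRINT {GZK, modularity ×2, Lim@2, FW, Cassels} + ONE research object: statement (A) at `(W,2)` on the IRREDUCIBLE
curves with NON-abelian `ℚ(E[2])` (`hAnaMI`, v8's binder; abelian = cyclic cubic image is PRINT via
`conjA_two_of_isAbelianGalois_divisionField_two`). Branches: irreducible → `missingUpperBoundAt_of_katoSharp_at` fed by
`katoSharpAtTwoAdditive_of_reading_of_negOne_of_negTwo`; reducible → §3. No over-`K` object, no Milne, no Hoffstein–Luo, no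
sibling crux. Conditional; nothing asserted.
[cite: Kato2004Asterisque, Thm. 12.5 (3)(4) and (12.5.1) (p. 222), Conj. 12.10 (p. 224), 13.13 (pp. 233–234), §14.14 and Prop. 14.16 (2) (pp. 243–245)]
[cite: CoatesSujatha2005, statement (A)] [cite: Lim2017FineSelmer, §3 Thm. 3.5] [cite: FerreroWashington1979, Theorem]
[cite: Cassels1965ArithmeticVIII] [cite: Miller2011LMS, Def. 1.1] -/
theorem addPotMult_upper_two_of_readings_of_targets
    (hGZK : rank_eq_analyticRank_of_analyticRank_le_one) (hrat : hasEntireLFunction_rat) (hmodN : exists_isNewformOf)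
    (hLim2 : Lim2017.thm35_at_two_fineSelmerDual_moduleFinite_of_classicalMuVanishes_of_le_divisionField_four)
    (hFW : ferreroWashington1979_classicalMuVanishes) (hCassels : bsdRHS_eq_of_isIsogenous)
    (hNST2 : Kato2004.rankZero_padicValNat_sha_add_padicValNat_tamagawa_le_at_two_of_noSplitTwistNegOneNegTwo_of_irreducible_of_fineSelmerDual_fg)
    (hinS : Kato2004.exists_memberHullInputs_two_sharp_of_noSplitTwistNegOneNegTwo)
    (h₁ : KatoSharpAtTwoAdditiveNegOneSplitTwist) (h₂ : KatoSharpAtTwoAdditiveNegTwoSplitTwist)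
    (hR₁ : KatoMemberSharpAtTwoAdditiveNegOneSplitTwistReducible)
    (hR₂ : KatoMemberSharpAtTwoAdditiveNegTwoSplitTwistReducible)
    (hAnaMI : ∀ (W : WeierstrassCurve ℚ) [W.IsElliptic] [W.IsGloballyMinimal], ¬ W.HasCM → W.analyticRank = 0 →
      Addv W 2 → padicValRat 2 W.j < 0 → W.HasIrreducibleModPGaloisRep 2 → ¬ IsAbelianGalois ℚ (W.divisionField 2) →
      ∀ (κ : ZpExtension ℚ 2), κ.IsCyclotomic →
        ∃ (γ : Field.absoluteGaloisGroup ℚ) (D : W.FineSelmerDualData κ γ),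
          Module.Finite ℤ_[2] (RestrictScalars ℤ_[2] (IwasawaAlgebra 2) D.X)) :
    ∀ (W : WeierstrassCurve ℚ) [W.IsElliptic] [W.IsGloballyMinimal], ¬ W.HasCM → W.analyticRank = 0 →
      Addv W 2 → padicValRat 2 W.j < 0 → MissingUpperBoundAt W 2 := by
  intro W _ _ hcm hr hadd hj
  by_cases hirr : W.HasIrreducibleModPGaloisRep 2
  · -- irreducible: the sharp Kato bound for EVERY additive irreducible curve ((NST′) reading + the two GEN 16 blocks) + (A)
    have hA : ∀ (κ : ZpExtension ℚ 2), κ.IsCyclotomic →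
        ∃ (γ : Field.absoluteGaloisGroup ℚ) (D : W.FineSelmerDualData κ γ),
          Module.Finite ℤ_[2] (RestrictScalars ℤ_[2] (IwasawaAlgebra 2) D.X) := by
      by_cases hab : IsAbelianGalois ℚ (W.divisionField 2)
      · haveI := hab
        exact conjA_two_of_isAbelianGalois_divisionField_two hLim2 hFW W
      · exact hAnaMI W hcm hr hadd hj hirr hab
    exact missingUpperBoundAt_of_katoSharp_at hGZK hrat W hr hirr
      (fun hL hfin => katoSharpAtTwoAdditive_of_reading_of_negOne_of_negTwo hNST2 h₁ h₂ W hcm hadd.1 hadd.2 hirr hA hL hfin)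
  · -- reducible: §3
    exact addReducibleUpper_two_of_sharpMember_of_targets hmodN hrat hinS hLim2 hFW hCassels hGZK hR₁ hR₂ W hcm hr hadd hirr

/-! ## §5 C4″ BY NAME from the Kato side + the LOWER half over `ℚ`; C4″ ⟺ that lower half -/

/-- **C4″ `AdditivePotMultOverKAtTwo` (item stmt-BirchSwinnertonDyer-22618; type = the route decl VERBATIM) from the Kato side
and the LOWER half over `ℚ` on the potentially multiplicative block.** Inputs: PRINT {`hGZK`, `hrat`, `hmodN`, `hMilneC`, `hLim2`,
`hFW`, `hCassels`} + the sibling crux `hMult` (`MultiplicativeRankZeroAtTwo`, item 19096 — needed only to DRESS `BSD₂(W)` over the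
semistabilising field, `additivePotMultOverKAtTwo_of_upper_of_lower`) + READINGS {`hNST2`, `hinS`} + TARGETS {`h₁`, `h₂`, `hR₁`,
`hR₂`} + research `∀`-objects {`hAnaMI` = (A) on the irreducible non-abelian-`ℚ(E[2])` pot-mult curves, `hLowM` = the LOWER half
`MissingLowerBoundAt W 2` on the whole pot-mult block}. So the child's honest residual is {Eisenstein half on 463 classes, (A) on
the `S₃`-image ones} modulo {2 readings, 4 Kato-side block targets, PRINT, sibling}; NO over-`K` mathematics is left in it.
Conditional (audit `proof.conditional`); the item is NOT closed.
[cite: Kato2004Asterisque, Thm. 12.5 (3) and (12.5.1) (p. 222), Conj. 12.10 (p. 224), Prop. 14.16 (2) (pp. 244–245)]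
[cite: Milne1972ArithmeticAV, §1 Thm. 1] [cite: CoatesSujatha2005, statement (A)] [cite: Cassels1965ArithmeticVIII]
[cite: Miller2011LMS, §1 and Def. 1.1] -/
theorem additivePotMultOverKAtTwo_of_readings_of_targets_of_lower
    (hGZK : rank_eq_analyticRank_of_analyticRank_le_one) (hrat : hasEntireLFunction_rat) (hmodN : exists_isNewformOf)
    (hMilneC : Milne1972.bsdQuotient_baseChange_quadratic_anyModel)
    (hLim2 : Lim2017.thm35_at_two_fineSelmerDual_moduleFinite_of_classicalMuVanishes_of_le_divisionField_four)
    (hFW : ferreroWashington1979_classicalMuVanishes) (hCassels : bsdRHS_eq_of_isIsogenous)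
    (hMult : MultiplicativeRankZeroAtTwo)
    (hNST2 : Kato2004.rankZero_padicValNat_sha_add_padicValNat_tamagawa_le_at_two_of_noSplitTwistNegOneNegTwo_of_irreducible_of_fineSelmerDual_fg)
    (hinS : Kato2004.exists_memberHullInputs_two_sharp_of_noSplitTwistNegOneNegTwo)
    (h₁ : KatoSharpAtTwoAdditiveNegOneSplitTwist) (h₂ : KatoSharpAtTwoAdditiveNegTwoSplitTwist)
    (hR₁ : KatoMemberSharpAtTwoAdditiveNegOneSplitTwistReducible)
    (hR₂ : KatoMemberSharpAtTwoAdditiveNegTwoSplitTwistReducible)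
    (hAnaMI : ∀ (W : WeierstrassCurve ℚ) [W.IsElliptic] [W.IsGloballyMinimal], ¬ W.HasCM → W.analyticRank = 0 →
      Addv W 2 → padicValRat 2 W.j < 0 → W.HasIrreducibleModPGaloisRep 2 → ¬ IsAbelianGalois ℚ (W.divisionField 2) →
      ∀ (κ : ZpExtension ℚ 2), κ.IsCyclotomic →
        ∃ (γ : Field.absoluteGaloisGroup ℚ) (D : W.FineSelmerDualData κ γ),
          Module.Finite ℤ_[2] (RestrictScalars ℤ_[2] (IwasawaAlgebra 2) D.X))
    (hLowM : ∀ (W : WeierstrassCurve ℚ) [W.IsElliptic] [W.IsGloballyMinimal], ¬ W.HasCM → W.analyticRank = 0 →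
      Addv W 2 → padicValRat 2 W.j < 0 → MissingLowerBoundAt W 2) :
    Summit.BirchSwinnertonDyer.BirchSwinnertonDyer.Theses.ByReductionTypeAtTwo.AdditivePotMultOverKAtTwo :=
  additivePotMultOverKAtTwo_of_upper_of_lower hGZK hrat hMilneC hMult
    (addPotMult_upper_two_of_readings_of_targets hGZK hrat hmodN hLim2 hFW hCassels hNST2 hinS h₁ h₂ hR₁ hR₂ hAnaMI)
    hLowM

/-- **The LOWER-half binder is a genuine PART of C4″** (bookkeeping): granted PRINT {GZK, modularity, Milne any-model,
Hoffstein–Luo} and the sibling `MultiplicativeRankZeroAtTwo`, C4″ gives `BSD₂(W)` on the block (Price,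
`bsdp_potMult_of_additivePotMultOverKAtTwo`), hence `MissingLowerBoundAt W 2` (`missingPPartAt_of_bsdp`, `Ш` finite by GZK).
[cite: Milne1972ArithmeticAV, §1 Thm. 1] [cite: HoffsteinLuo1997, Theorem] [cite: Miller2011LMS, §1 and Def. 1.1] -/
theorem hLowM_of_additivePotMultOverKAtTwo (hGZK : rank_eq_analyticRank_of_analyticRank_le_one)
    (hrat : hasEntireLFunction_rat) (hMilneC : Milne1972.bsdQuotient_baseChange_quadratic_anyModel)
    (hHL : HoffsteinLuo1997_exists_twist_L_one_ne_zero) (hMult : MultiplicativeRankZeroAtTwo)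
    (h : Summit.BirchSwinnertonDyer.BirchSwinnertonDyer.Theses.ByReductionTypeAtTwo.AdditivePotMultOverKAtTwo) :
    ∀ (W : WeierstrassCurve ℚ) [W.IsElliptic] [W.IsGloballyMinimal], ¬ W.HasCM → W.analyticRank = 0 →
      Addv W 2 → padicValRat 2 W.j < 0 → MissingLowerBoundAt W 2 := by
  intro W _ _ hcm hr hadd hj
  haveI : Fact (Nat.Prime 2) := ⟨Nat.prime_two⟩
  have hr1 : W.analyticRank ≤ 1 := by rw [hr]; exact zero_le_one
  haveI : Finite W.sha := (hGZK W hr1).2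
  exact (lower_and_upper_of_missingPPartAt W 2
    (missingPPartAt_of_bsdp W 2 (bsdp_potMult_of_additivePotMultOverKAtTwo hGZK hrat hMilneC hHL hMult h W hcm hr hadd hj))).1

/-- **C4″ ⟺ the LOWER half over `ℚ` on the potentially multiplicative block, granted the Kato side.** GRANTED PRINT {GZK,
modularity ×2, Milne any-model, Hoffstein–Luo, Lim@2, FW, Cassels}, the sibling `MultiplicativeRankZeroAtTwo`, the readings
`hNST2`/`hinS`, the four block targets and (A) on the `S₃`-image pot-mult curves: `AdditivePotMultOverKAtTwo` ↔ (the lower half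
`MissingLowerBoundAt W 2` for every non-CM globally minimal `W` of analytic rank `0`, additive at `2` with `ord₂ j < 0`).
Conditional iff (audit `proof.conditional`); nothing asserted about either side; the item is NOT closed.
[cite: Kato2004Asterisque, Conj. 12.10 (p. 224), Prop. 14.16 (2) (pp. 244–245)] [cite: Milne1972ArithmeticAV, §1 Thm. 1]
[cite: HoffsteinLuo1997, Theorem] [cite: Miller2011LMS, §1 and Def. 1.1] -/
theorem additivePotMultOverKAtTwo_iff_lower_of_readings_of_targets
    (hGZK : rank_eq_analyticRank_of_analyticRank_le_one) (hrat : hasEntireLFunction_rat) (hmodN : exists_isNewformOf)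
    (hMilneC : Milne1972.bsdQuotient_baseChange_quadratic_anyModel) (hHL : HoffsteinLuo1997_exists_twist_L_one_ne_zero)
    (hLim2 : Lim2017.thm35_at_two_fineSelmerDual_moduleFinite_of_classicalMuVanishes_of_le_divisionField_four)
    (hFW : ferreroWashington1979_classicalMuVanishes) (hCassels : bsdRHS_eq_of_isIsogenous)
    (hMult : MultiplicativeRankZeroAtTwo)
    (hNST2 : Kato2004.rankZero_padicValNat_sha_add_padicValNat_tamagawa_le_at_two_of_noSplitTwistNegOneNegTwo_of_irreducible_of_fineSelmerDual_fg)
    (hinS : Kato2004.exists_memberHullInputs_two_sharp_of_noSplitTwistNegOneNegTwo)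
    (h₁ : KatoSharpAtTwoAdditiveNegOneSplitTwist) (h₂ : KatoSharpAtTwoAdditiveNegTwoSplitTwist)
    (hR₁ : KatoMemberSharpAtTwoAdditiveNegOneSplitTwistReducible)
    (hR₂ : KatoMemberSharpAtTwoAdditiveNegTwoSplitTwistReducible)
    (hAnaMI : ∀ (W : WeierstrassCurve ℚ) [W.IsElliptic] [W.IsGloballyMinimal], ¬ W.HasCM → W.analyticRank = 0 →
      Addv W 2 → padicValRat 2 W.j < 0 → W.HasIrreducibleModPGaloisRep 2 → ¬ IsAbelianGalois ℚ (W.divisionField 2) →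
      ∀ (κ : ZpExtension ℚ 2), κ.IsCyclotomic →
        ∃ (γ : Field.absoluteGaloisGroup ℚ) (D : W.FineSelmerDualData κ γ),
          Module.Finite ℤ_[2] (RestrictScalars ℤ_[2] (IwasawaAlgebra 2) D.X)) :
    Summit.BirchSwinnertonDyer.BirchSwinnertonDyer.Theses.ByReductionTypeAtTwo.AdditivePotMultOverKAtTwo ↔
      ∀ (W : WeierstrassCurve ℚ) [W.IsElliptic] [W.IsGloballyMinimal], ¬ W.HasCM → W.analyticRank = 0 →
        Addv W 2 → padicValRat 2 W.j < 0 → MissingLowerBoundAt W 2 :=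
  ⟨hLowM_of_additivePotMultOverKAtTwo hGZK hrat hMilneC hHL hMult,
    additivePotMultOverKAtTwo_of_readings_of_targets_of_lower hGZK hrat hmodN hMilneC hLim2 hFW hCassels hMult hNST2 hinS
      h₁ h₂ hR₁ hR₂ hAnaMI⟩

end Summit.BirchSwinnertonDyer.BirchSwinnertonDyer.Theorems.AddKatoTwo

end
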